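import Summits.FinalStateConjecture.FinalStateConjecture.Theorems.EIHFluxBalanceInertialRecessionStubSlaving3FarFieldPrep

/-!
# Route EIHFluxBalance — `InertialRecession` (E′), line `SketchCleanExcision`, skeleton r13,
# stub `stub_higherOrderSlaving` (EF): one-variable chain rule to order three

Helper file for the crux `stmt-FinalStateConjecture-17403`
(`Summit.FinalStateConjecture.FinalStateConjecture.Theses.EIHFluxBalance.InertialRecession`, E′),
registered stub `stub_higherOrderSlaving` (orders two and three of frozen-vacuum slaving).

The second and third lab-time derivatives of a painted Kerr–Schild summand are derivatives of a
composite `Ψ ∘ γ` of a smooth map `Ψ` of several variables (the Kerr–Schild form as a function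
of spin, frame and rest position) with a smooth one-parameter path `γ` (the moduli). This file
records the elementary calculus used for all of them:

* `higherOrder_deriv_comp₃` — the chain rule to order three along a path:
  `(Ψ∘γ)′ = DΨ(γ)γ′`, `(Ψ∘γ)″ = D²Ψ(γ)(γ′,γ′) + DΨ(γ)γ″`,
  `(Ψ∘γ)‴ = D³Ψ(γ)(γ′,γ′,γ′) + D²Ψ(γ)(γ″,γ′) + 2 D²Ψ(γ)(γ′,γ″) + DΨ(γ)γ‴`;
* `higherOrder_norm_deriv_comp₃_le` — the resulting LINEAR-PLUS-GARBAGE bounds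
  `‖(Ψ∘γ)″ − DΨ(γ)γ″‖ ≤ C‖γ′‖²`, `‖(Ψ∘γ)‴ − DΨ(γ)γ‴‖ ≤ C(‖γ′‖³ + 3‖γ″‖‖γ′‖)` and the crude
  bounds, when `‖DᵏΨ‖ ≤ C` (`k ≤ 3`) at `γ(t)`;
* `higherOrder_norm_fderiv_affine_le` — derivatives in the point of `z ↦ DᵏΨ(p₀ + L z)(q…)`.

Pure calculus; no definitions, no named facts, no `sorry`.
-/

set_option linter.dupNamespace false
set_option maxSynthPendingDepth 3

noncomputable section

namespace Summit.FinalStateConjecture.FinalStateConjecture.Theorems.SublinearIsFree.Slaving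

open scoped Topology ContDiff
open Filter Set Function

section CompThree

variable {P F : Type*} [NormedAddCommGroup P] [NormedSpace ℝ P] [NormedAddCommGroup F]
  [NormedSpace ℝ F]

/-- `‖Df(p)‖ = ‖D¹f(p)‖` (Mathlib's `norm_iteratedFDeriv_fderiv`, order one). [folklore] -/
theorem higherOrder_norm_fderiv_one (f : P → F) (p : P) :
    ‖fderiv ℝ f p‖ = ‖iteratedFDeriv ℝ 1 f p‖ := by
  rw [← norm_iteratedFDeriv_fderiv (n := 0), norm_iteratedFDeriv_zero]

/-- `‖D(Df)(p)‖ = ‖D²f(p)‖`. [folklore] -/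
theorem higherOrder_norm_fderiv_two (f : P → F) (p : P) :
    ‖fderiv ℝ (fderiv ℝ f) p‖ = ‖iteratedFDeriv ℝ 2 f p‖ := by
  rw [← norm_iteratedFDeriv_fderiv (n := 1), ← norm_iteratedFDeriv_fderiv (n := 0),
    norm_iteratedFDeriv_zero]

/-- `‖D(D(Df))(p)‖ = ‖D³f(p)‖`. [folklore] -/
theorem higherOrder_norm_fderiv_three (f : P → F) (p : P) :
    ‖fderiv ℝ (fderiv ℝ (fderiv ℝ f)) p‖ = ‖iteratedFDeriv ℝ 3 f p‖ := by
  rw [← norm_iteratedFDeriv_fderiv (n := 2), ← norm_iteratedFDeriv_fderiv (n := 1),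
    ← norm_iteratedFDeriv_fderiv (n := 0), norm_iteratedFDeriv_zero]

/-- A smooth path has all its iterated derivatives as derivatives:
`HasDerivAt γ⁽ᵏ⁾ (γ⁽ᵏ⁺¹⁾ s) s`. [folklore] -/
theorem higherOrder_hasDerivAt_iteratedDeriv {γ : ℝ → P} (hγ : ContDiff ℝ ∞ γ) (k : ℕ) (s : ℝ) :
    HasDerivAt (iteratedDeriv k γ) (iteratedDeriv (k + 1) γ s) s := by
  rw [iteratedDeriv_succ]
  exact ((hγ.differentiable_iteratedDeriv k (by exact_mod_cast ENat.coe_lt_top k))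
    s).hasDerivAt

/-- **Chain rule to order three along a path.** `Ψ` smooth on an open `O`, `γ` a smooth path
with `γ(t) ∈ O`: the first three derivatives of `Ψ ∘ γ` at `t`. [folklore] -/
theorem higherOrder_deriv_comp₃ {Ψ : P → F} {O : Set P} (hO : IsOpen O) (hΨ : ContDiffOn ℝ ∞ Ψ O)
    {γ : ℝ → P} (hγ : ContDiff ℝ ∞ γ) {t : ℝ} (ht : γ t ∈ O) :
    deriv (Ψ ∘ γ) t = fderiv ℝ Ψ (γ t) (deriv γ t) ∧
    iteratedDeriv 2 (Ψ ∘ γ) t = fderiv ℝ (fderiv ℝ Ψ) (γ t) (deriv γ t) (deriv γ t) +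
      fderiv ℝ Ψ (γ t) (iteratedDeriv 2 γ t) ∧
    iteratedDeriv 3 (Ψ ∘ γ) t =
      fderiv ℝ (fderiv ℝ (fderiv ℝ Ψ)) (γ t) (deriv γ t) (deriv γ t) (deriv γ t) +
      (fderiv ℝ (fderiv ℝ Ψ) (γ t) (iteratedDeriv 2 γ t) (deriv γ t) +
        (2 : ℝ) • fderiv ℝ (fderiv ℝ Ψ) (γ t) (deriv γ t) (iteratedDeriv 2 γ t)) +
      fderiv ℝ Ψ (γ t) (iteratedDeriv 3 γ t) := by
  -- notation and smoothness of the derivatives of `Ψ` on `O`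
  set Ψ₁ := fderiv ℝ Ψ with hΨ₁
  set Ψ₂ := fderiv ℝ Ψ₁ with hΨ₂
  set Ψ₃ := fderiv ℝ Ψ₂ with hΨ₃
  have hΨ₁c : ContDiffOn ℝ ∞ Ψ₁ O := hΨ.fderiv_of_isOpen hO (by simp)
  have hΨ₂c : ContDiffOn ℝ ∞ Ψ₂ O := hΨ₁c.fderiv_of_isOpen hO (by simp)
  have hdΨ : ∀ p ∈ O, HasFDerivAt Ψ (Ψ₁ p) p := fun p hp ↦
    ((hΨ.differentiableOn (by simp)).differentiableAt (hO.mem_nhds hp)).hasFDerivAt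
  have hdΨ₁ : ∀ p ∈ O, HasFDerivAt Ψ₁ (Ψ₂ p) p := fun p hp ↦
    ((hΨ₁c.differentiableOn (by simp)).differentiableAt (hO.mem_nhds hp)).hasFDerivAt
  have hdΨ₂ : ∀ p ∈ O, HasFDerivAt Ψ₂ (Ψ₃ p) p := fun p hp ↦
    ((hΨ₂c.differentiableOn (by simp)).differentiableAt (hO.mem_nhds hp)).hasFDerivAt
  -- the path and its derivatives
  set γ₁ := deriv γ with hγ₁
  set γ₂ := iteratedDeriv 2 γ with hγ₂
  set γ₃ := iteratedDeriv 3 γ with hγ₃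
  have hd₀ : ∀ s, HasDerivAt γ (γ₁ s) s := fun s ↦ by
    have h := higherOrder_hasDerivAt_iteratedDeriv hγ 0 s
    rwa [iteratedDeriv_zero, iteratedDeriv_one] at h
  have hd₁ : ∀ s, HasDerivAt γ₁ (γ₂ s) s := fun s ↦ by
    have h := higherOrder_hasDerivAt_iteratedDeriv hγ 1 s
    rwa [iteratedDeriv_one] at h
  have hd₂ : ∀ s, HasDerivAt γ₂ (γ₃ s) s := fun s ↦ higherOrder_hasDerivAt_iteratedDeriv hγ 2 s
  -- the open set of good parameters
  set U : Set ℝ := γ ⁻¹' O with hU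
  have hUo : IsOpen U := hO.preimage hγ.continuous
  have htU : t ∈ U := ht
  -- order one, on `U`
  set f₁ : ℝ → F := fun s ↦ Ψ₁ (γ s) (γ₁ s) with hf₁
  have h1 : ∀ s ∈ U, HasDerivAt (Ψ ∘ γ) (f₁ s) s := fun s hs ↦
    (hdΨ (γ s) hs).comp_hasDerivAt s (hd₀ s)
  have h1eq : deriv (Ψ ∘ γ) =ᶠ[𝓝 t] f₁ := by
    filter_upwards [hUo.mem_nhds htU] with s hs using (h1 s hs).deriv
  -- order two, on `U`
  set f₂ : ℝ → F := fun s ↦ Ψ₂ (γ s) (γ₁ s) (γ₁ s) + Ψ₁ (γ s) (γ₂ s) with hf₂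
  have h2 : ∀ s ∈ U, HasDerivAt f₁ (f₂ s) s := by
    intro s hs
    have hc : HasDerivAt (fun r ↦ Ψ₁ (γ r)) (Ψ₂ (γ s) (γ₁ s)) s :=
      (hdΨ₁ (γ s) hs).comp_hasDerivAt s (hd₀ s)
    exact hc.clm_apply (hd₁ s)
  have h2U : ∀ s ∈ U, iteratedDeriv 2 (Ψ ∘ γ) s = f₂ s := by
    intro s hs
    have heq : deriv (Ψ ∘ γ) =ᶠ[𝓝 s] f₁ := by
      filter_upwards [hUo.mem_nhds hs] with r hr using (h1 r hr).deriv
    rw [iteratedDeriv_succ, iteratedDeriv_one, heq.deriv_eq, (h2 s hs).deriv]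
  have h2eq : iteratedDeriv 2 (Ψ ∘ γ) =ᶠ[𝓝 t] f₂ := by
    filter_upwards [hUo.mem_nhds htU] with s hs using h2U s hs
  -- order three, at `t`
  have h3 : HasDerivAt f₂ (Ψ₃ (γ t) (γ₁ t) (γ₁ t) (γ₁ t) +
      (Ψ₂ (γ t) (γ₂ t) (γ₁ t) + (2 : ℝ) • Ψ₂ (γ t) (γ₁ t) (γ₂ t)) + Ψ₁ (γ t) (γ₃ t)) t := by
    have hc₂ : HasDerivAt (fun r ↦ Ψ₂ (γ r)) (Ψ₃ (γ t) (γ₁ t)) t :=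
      (hdΨ₂ (γ t) ht).comp_hasDerivAt t (hd₀ t)
    have hc₂' : HasDerivAt (fun r ↦ Ψ₂ (γ r) (γ₁ r)) (Ψ₃ (γ t) (γ₁ t) (γ₁ t) + Ψ₂ (γ t) (γ₂ t)) t :=
      hc₂.clm_apply (hd₁ t)
    have hA : HasDerivAt (fun r ↦ Ψ₂ (γ r) (γ₁ r) (γ₁ r))
        ((Ψ₃ (γ t) (γ₁ t) (γ₁ t) + Ψ₂ (γ t) (γ₂ t)) (γ₁ t) + Ψ₂ (γ t) (γ₁ t) (γ₂ t)) t :=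
      hc₂'.clm_apply (hd₁ t)
    have hc₁ : HasDerivAt (fun r ↦ Ψ₁ (γ r)) (Ψ₂ (γ t) (γ₁ t)) t :=
      (hdΨ₁ (γ t) ht).comp_hasDerivAt t (hd₀ t)
    have hB : HasDerivAt (fun r ↦ Ψ₁ (γ r) (γ₂ r)) (Ψ₂ (γ t) (γ₁ t) (γ₂ t) + Ψ₁ (γ t) (γ₃ t)) t :=
      hc₁.clm_apply (hd₂ t)
    have h := hA.add hB
    refine h.congr_deriv ?_
    simp only [_root_.add_apply, two_smul]
    abel
  refine ⟨(h1 t htU).deriv, h2eq.eq_of_nhds, ?_⟩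
  rw [iteratedDeriv_succ, h2eq.deriv_eq, h3.deriv]

/-- Operator-norm bound for a trilinear value. [folklore] -/
theorem higherOrder_norm_apply₃_le {P₁ P₂ P₃ : Type*} [NormedAddCommGroup P₁] [NormedSpace ℝ P₁]
    [NormedAddCommGroup P₂] [NormedSpace ℝ P₂] [NormedAddCommGroup P₃] [NormedSpace ℝ P₃]
    (T : P₁ →L[ℝ] P₂ →L[ℝ] P₃ →L[ℝ] F) (u : P₁) (v : P₂) (w : P₃) :
    ‖T u v w‖ ≤ ‖T‖ * ‖u‖ * ‖v‖ * ‖w‖ :=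
  ((T u v).le_opNorm w).trans (mul_le_mul_of_nonneg_right (T.le_opNorm₂ u v) (norm_nonneg w))

/-- **Linear-plus-garbage bounds for the derivatives of a composite.** With `‖DᵏΨ(γ(t))‖ ≤ C`
(`k = 1, 2, 3`): `‖(Ψ∘γ)′‖ ≤ C‖γ′‖`, `‖(Ψ∘γ)″ − DΨ(γ)γ″‖ ≤ C‖γ′‖²`,
`‖(Ψ∘γ)‴ − DΨ(γ)γ‴‖ ≤ C(‖γ′‖³ + 3‖γ″‖‖γ′‖)`, and the crude bounds
`‖(Ψ∘γ)″‖ ≤ C(‖γ″‖ + ‖γ′‖²)`, `‖(Ψ∘γ)‴‖ ≤ C(‖γ‴‖ + 3‖γ″‖‖γ′‖ + ‖γ′‖³)`. [folklore] -/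
theorem higherOrder_norm_deriv_comp₃_le {Ψ : P → F} {O : Set P} (hO : IsOpen O)
    (hΨ : ContDiffOn ℝ ∞ Ψ O) {γ : ℝ → P} (hγ : ContDiff ℝ ∞ γ) {t : ℝ} (ht : γ t ∈ O) {C : ℝ}
    (hC₁ : ‖iteratedFDeriv ℝ 1 Ψ (γ t)‖ ≤ C) (hC₂ : ‖iteratedFDeriv ℝ 2 Ψ (γ t)‖ ≤ C)
    (hC₃ : ‖iteratedFDeriv ℝ 3 Ψ (γ t)‖ ≤ C) :
    ‖deriv (Ψ ∘ γ) t‖ ≤ C * ‖deriv γ t‖ ∧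
    ‖iteratedDeriv 2 (Ψ ∘ γ) t - fderiv ℝ Ψ (γ t) (iteratedDeriv 2 γ t)‖ ≤ C * ‖deriv γ t‖ ^ 2 ∧
    ‖iteratedDeriv 3 (Ψ ∘ γ) t - fderiv ℝ Ψ (γ t) (iteratedDeriv 3 γ t)‖ ≤
      C * (‖deriv γ t‖ ^ 3 + 3 * ‖iteratedDeriv 2 γ t‖ * ‖deriv γ t‖) ∧
    ‖iteratedDeriv 2 (Ψ ∘ γ) t‖ ≤ C * (‖iteratedDeriv 2 γ t‖ + ‖deriv γ t‖ ^ 2) ∧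
    ‖iteratedDeriv 3 (Ψ ∘ γ) t‖ ≤
      C * (‖iteratedDeriv 3 γ t‖ + 3 * ‖iteratedDeriv 2 γ t‖ * ‖deriv γ t‖ + ‖deriv γ t‖ ^ 3) := by
  obtain ⟨e1, e2, e3⟩ := higherOrder_deriv_comp₃ hO hΨ hγ ht
  have hC0 : 0 ≤ C := (norm_nonneg _).trans hC₁
  rw [← higherOrder_norm_fderiv_one] at hC₁
  rw [← higherOrder_norm_fderiv_two] at hC₂
  rw [← higherOrder_norm_fderiv_three] at hC₃
  set a := ‖deriv γ t‖ with ha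
  set b := ‖iteratedDeriv 2 γ t‖ with hb
  set c := ‖iteratedDeriv 3 γ t‖ with hc
  have ha0 : 0 ≤ a := norm_nonneg _
  have hb0 : 0 ≤ b := norm_nonneg _
  have hc0 : 0 ≤ c := norm_nonneg _
  -- the individual terms
  have t1 : ‖fderiv ℝ Ψ (γ t) (deriv γ t)‖ ≤ C * a :=
    ((fderiv ℝ Ψ (γ t)).le_opNorm _).trans (mul_le_mul_of_nonneg_right hC₁ ha0)
  have t2 : ‖fderiv ℝ Ψ (γ t) (iteratedDeriv 2 γ t)‖ ≤ C * b :=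
    ((fderiv ℝ Ψ (γ t)).le_opNorm _).trans (mul_le_mul_of_nonneg_right hC₁ hb0)
  have t3 : ‖fderiv ℝ Ψ (γ t) (iteratedDeriv 3 γ t)‖ ≤ C * c :=
    ((fderiv ℝ Ψ (γ t)).le_opNorm _).trans (mul_le_mul_of_nonneg_right hC₁ hc0)
  have t11 : ‖fderiv ℝ (fderiv ℝ Ψ) (γ t) (deriv γ t) (deriv γ t)‖ ≤ C * a ^ 2 := by
    refine ((fderiv ℝ (fderiv ℝ Ψ) (γ t)).le_opNorm₂ _ _).trans ?_
    rw [sq, ← mul_assoc]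
    exact mul_le_mul_of_nonneg_right (mul_le_mul_of_nonneg_right hC₂ ha0) ha0
  have t21 : ‖fderiv ℝ (fderiv ℝ Ψ) (γ t) (iteratedDeriv 2 γ t) (deriv γ t)‖ ≤ C * b * a :=
    ((fderiv ℝ (fderiv ℝ Ψ) (γ t)).le_opNorm₂ _ _).trans
      (mul_le_mul_of_nonneg_right (mul_le_mul_of_nonneg_right hC₂ hb0) ha0)
  have t12 : ‖fderiv ℝ (fderiv ℝ Ψ) (γ t) (deriv γ t) (iteratedDeriv 2 γ t)‖ ≤ C * b * a := by
    refine ((fderiv ℝ (fderiv ℝ Ψ) (γ t)).le_opNorm₂ _ _).trans ?_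
    calc ‖fderiv ℝ (fderiv ℝ Ψ) (γ t)‖ * ‖deriv γ t‖ * ‖iteratedDeriv 2 γ t‖
        = ‖fderiv ℝ (fderiv ℝ Ψ) (γ t)‖ * b * a := by rw [← ha, ← hb]; ring
      _ ≤ C * b * a := mul_le_mul_of_nonneg_right (mul_le_mul_of_nonneg_right hC₂ hb0) ha0
  have t111 : ‖fderiv ℝ (fderiv ℝ (fderiv ℝ Ψ)) (γ t) (deriv γ t) (deriv γ t) (deriv γ t)‖ ≤
      C * a ^ 3 := by
    refine (higherOrder_norm_apply₃_le _ _ _ _).trans ?_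
    rw [← ha]
    calc ‖fderiv ℝ (fderiv ℝ (fderiv ℝ Ψ)) (γ t)‖ * a * a * a
        = ‖fderiv ℝ (fderiv ℝ (fderiv ℝ Ψ)) (γ t)‖ * a ^ 3 := by ring
      _ ≤ C * a ^ 3 := mul_le_mul_of_nonneg_right hC₃ (by positivity)
  refine ⟨?_, ?_, ?_, ?_, ?_⟩
  · rw [e1]; exact t1
  · rw [e2, add_sub_cancel_right]; exact t11
  · rw [e3, add_sub_cancel_right]
    calc _ ≤ ‖fderiv ℝ (fderiv ℝ (fderiv ℝ Ψ)) (γ t) (deriv γ t) (deriv γ t) (deriv γ t)‖ +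
          ‖fderiv ℝ (fderiv ℝ Ψ) (γ t) (iteratedDeriv 2 γ t) (deriv γ t) +
            (2 : ℝ) • fderiv ℝ (fderiv ℝ Ψ) (γ t) (deriv γ t) (iteratedDeriv 2 γ t)‖ :=
          norm_add_le _ _
      _ ≤ C * a ^ 3 + (C * b * a + 2 * (C * b * a)) := by
          refine add_le_add t111 ((norm_add_le _ _).trans (add_le_add t21 ?_))
          rw [norm_smul, Real.norm_eq_abs, abs_two]
          exact mul_le_mul_of_nonneg_left t12 zero_le_two
      _ = C * (a ^ 3 + 3 * b * a) := by ring
  · rw [e2]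
    calc _ ≤ ‖fderiv ℝ (fderiv ℝ Ψ) (γ t) (deriv γ t) (deriv γ t)‖ +
          ‖fderiv ℝ Ψ (γ t) (iteratedDeriv 2 γ t)‖ := norm_add_le _ _
      _ ≤ C * a ^ 2 + C * b := add_le_add t11 t2
      _ = C * (b + a ^ 2) := by ring
  · rw [e3]
    calc _ ≤ ‖fderiv ℝ (fderiv ℝ (fderiv ℝ Ψ)) (γ t) (deriv γ t) (deriv γ t) (deriv γ t) +
          (fderiv ℝ (fderiv ℝ Ψ) (γ t) (iteratedDeriv 2 γ t) (deriv γ t) +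
            (2 : ℝ) • fderiv ℝ (fderiv ℝ Ψ) (γ t) (deriv γ t) (iteratedDeriv 2 γ t))‖ +
          ‖fderiv ℝ Ψ (γ t) (iteratedDeriv 3 γ t)‖ := norm_add_le _ _
      _ ≤ (C * a ^ 3 + (C * b * a + 2 * (C * b * a))) + C * c := by
          refine add_le_add ((norm_add_le _ _).trans (add_le_add t111
            ((norm_add_le _ _).trans (add_le_add t21 ?_)))) t3
          rw [norm_smul, Real.norm_eq_abs, abs_two]
          exact mul_le_mul_of_nonneg_left t12 zero_le_two
      _ = C * (c + 3 * b * a + a ^ 3) := by ring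

/-- **Derivatives in the point of a derivative evaluated along an affine family.** For `Ψ` smooth
on an open `O`, an affine map `z ↦ p₀ + L z` into `O` at `x`, and fixed directions: the functions
`z ↦ DΨ(p₀ + Lz) q` and `z ↦ D²Ψ(p₀ + Lz) q₁ q₂` are differentiable at `x` with
`D[z ↦ DΨ(p₀+Lz) q](x) v = D²Ψ(p₀+Lx)(Lv) q`, `D[z ↦ D²Ψ(p₀+Lz) q₁ q₂](x) v = D³Ψ(p₀+Lx)(Lv) q₁ q₂`,
and `D²[z ↦ DΨ(p₀+Lz) q](x) v w = D³Ψ(p₀+Lx)(Lv)(Lw) q`. [folklore] -/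
theorem higherOrder_fderiv_affine {E : Type*} [NormedAddCommGroup E] [NormedSpace ℝ E]
    {Ψ : P → F} {O : Set P} (hO : IsOpen O) (hΨ : ContDiffOn ℝ ∞ Ψ O) (p₀ : P) (L : E →L[ℝ] P)
    {x : E} (hx : p₀ + L x ∈ O) (q q₁ q₂ : P) :
    (∀ v, fderiv ℝ (fun z ↦ fderiv ℝ Ψ (p₀ + L z) q) x v =
      fderiv ℝ (fderiv ℝ Ψ) (p₀ + L x) (L v) q) ∧
    (∀ v, fderiv ℝ (fun z ↦ fderiv ℝ (fderiv ℝ Ψ) (p₀ + L z) q₁ q₂) x v =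
      fderiv ℝ (fderiv ℝ (fderiv ℝ Ψ)) (p₀ + L x) (L v) q₁ q₂) ∧
    (∀ v w, fderiv ℝ (fderiv ℝ (fun z ↦ fderiv ℝ Ψ (p₀ + L z) q)) x v w =
      fderiv ℝ (fderiv ℝ (fderiv ℝ Ψ)) (p₀ + L x) (L v) (L w) q) := by
  set Ψ₁ := fderiv ℝ Ψ with hΨ₁
  set Ψ₂ := fderiv ℝ Ψ₁ with hΨ₂
  set Ψ₃ := fderiv ℝ Ψ₂ with hΨ₃
  have hΨ₁c : ContDiffOn ℝ ∞ Ψ₁ O := hΨ.fderiv_of_isOpen hO (by simp)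
  have hΨ₂c : ContDiffOn ℝ ∞ Ψ₂ O := hΨ₁c.fderiv_of_isOpen hO (by simp)
  have hdΨ₁ : ∀ p ∈ O, HasFDerivAt Ψ₁ (Ψ₂ p) p := fun p hp ↦
    ((hΨ₁c.differentiableOn (by simp)).differentiableAt (hO.mem_nhds hp)).hasFDerivAt
  have hdΨ₂ : ∀ p ∈ O, HasFDerivAt Ψ₂ (Ψ₃ p) p := fun p hp ↦
    ((hΨ₂c.differentiableOn (by simp)).differentiableAt (hO.mem_nhds hp)).hasFDerivAt
  have hℓ : ∀ z : E, HasFDerivAt (fun z : E ↦ p₀ + L z) L z := fun z ↦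
    (L.hasFDerivAt).const_add p₀
  set U : Set E := (fun z : E ↦ p₀ + L z) ⁻¹' O with hU
  have hUo : IsOpen U := hO.preimage (continuous_const.add L.continuous)
  have hxU : x ∈ U := hx
  -- first derivative of `z ↦ Ψ₁(ℓ z) q` on `U`
  have hA : ∀ z ∈ U, HasFDerivAt (fun z ↦ Ψ₁ (p₀ + L z) q)
      ((Ψ₂ (p₀ + L z)).comp L |>.flip q) z := by
    intro z hz
    have hc : HasFDerivAt (fun z ↦ Ψ₁ (p₀ + L z)) ((Ψ₂ (p₀ + L z)).comp L) z :=
      (hdΨ₁ _ hz).comp z (hℓ z)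
    have h := hc.clm_apply (hasFDerivAt_const q z)
    simpa using h
  have hAx : ∀ v, fderiv ℝ (fun z ↦ Ψ₁ (p₀ + L z) q) x v = Ψ₂ (p₀ + L x) (L v) q := fun v ↦ by
    rw [(hA x hxU).fderiv]; rfl
  refine ⟨hAx, fun v ↦ ?_, fun v w ↦ ?_⟩
  · have hc : HasFDerivAt (fun z ↦ Ψ₂ (p₀ + L z)) ((Ψ₃ (p₀ + L x)).comp L) x :=
      (hdΨ₂ _ hx).comp x (hℓ x)
    have h := (hc.clm_apply (hasFDerivAt_const q₁ x)).clm_apply (hasFDerivAt_const q₂ x)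
    rw [h.fderiv]
    simp
  · -- the derivative of `z ↦ Ψ₁(ℓ z) q` is `z ↦ (Ψ₂(ℓ z) ∘ L).flip q` on `U`; differentiate again
    have heq : fderiv ℝ (fun z ↦ Ψ₁ (p₀ + L z) q) =ᶠ[𝓝 x]
        fun z ↦ ((Ψ₂ (p₀ + L z)).comp L).flip q := by
      filter_upwards [hUo.mem_nhds hxU] with z hz using (hA z hz).fderiv
    rw [heq.fderiv_eq]
    have hc : HasFDerivAt (fun z ↦ Ψ₂ (p₀ + L z)) ((Ψ₃ (p₀ + L x)).comp L) x :=
      (hdΨ₂ _ hx).comp x (hℓ x)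
    -- `T ↦ (T ∘ L).flip q` is a continuous linear map
    set Φ : (P →L[ℝ] P →L[ℝ] F) →L[ℝ] (E →L[ℝ] F) :=
      (ContinuousLinearMap.apply ℝ (E →L[ℝ] F) q).comp
        ((ContinuousLinearMap.flipₗᵢ ℝ E P F : (E →L[ℝ] P →L[ℝ] F) →L[ℝ] (P →L[ℝ] E →L[ℝ] F)).comp
          ((ContinuousLinearMap.compL ℝ E P (P →L[ℝ] F)).flip L)) with hΦ
    have hΦapp : ∀ T : P →L[ℝ] P →L[ℝ] F, Φ T = (T.comp L).flip q := fun T ↦ rfl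
    have h2 : HasFDerivAt (fun z ↦ ((Ψ₂ (p₀ + L z)).comp L).flip q)
        (Φ.comp ((Ψ₃ (p₀ + L x)).comp L)) x := by
      have := Φ.hasFDerivAt.comp x hc
      simpa [Function.comp_def, hΦapp] using this
    rw [h2.fderiv]
    rfl

/-- **Registered one-line carrier form** (`higherOrder_comp3_EF`) of `higherOrder_deriv_comp₃`:
the chain rule to order three along a smooth path. [folklore] -/
theorem higherOrder_comp3_EF : ∀ {P F : Type} [NormedAddCommGroup P] [NormedSpace ℝ P] [NormedAddCommGroup F] [NormedSpace ℝ F] {Ψ : P → F} {O : Set P}, IsOpen O → ContDiffOn ℝ ((⊤ : ℕ∞) : WithTop ℕ∞) Ψ O → ∀ {γ : ℝ → P}, ContDiff ℝ ((⊤ : ℕ∞) : WithTop ℕ∞) γ → ∀ {t : ℝ}, γ t ∈ O → deriv (Ψ ∘ γ) t = fderiv ℝ Ψ (γ t) (deriv γ t) ∧ iteratedDeriv 2 (Ψ ∘ γ) t = fderiv ℝ (fderiv ℝ Ψ) (γ t) (deriv γ t) (deriv γ t) + fderiv ℝ Ψ (γ t) (iteratedDeriv 2 γ t) ∧ iteratedDeriv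 3 (Ψ ∘ γ) t = fderiv ℝ (fderiv ℝ (fderiv ℝ Ψ)) (γ t) (deriv γ t) (deriv γ t) (deriv γ t) + (fderiv ℝ (fderiv ℝ Ψ) (γ t) (iteratedDeriv 2 γ t) (deriv γ t) + (2 : ℝ) • fderiv ℝ (fderiv ℝ Ψ) (γ t) (deriv γ t) (iteratedDeriv 2 γ t)) + fderiv ℝ Ψ (γ t) (iteratedDeriv 3 γ t) :=
  fun hO hΨ _ hγ _ ht ↦ higherOrder_deriv_comp₃ hO hΨ hγ ht

end CompThree

end Summit.FinalStateConjecture.FinalStateConjecture.Theorems.SublinearIsFree.Slaving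

end
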